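import Summits.MatrixMultiplication.OmegaCensus.STPPVosperSlackTwoLawABQ

/-!
# ω-census (abelian STPP census): `{(3,3,3),(3,3,4)} ⊄ ℤ₆₁` — slack-2 partition law, CASE B′ rows up to dihedral symmetry, part 7a (kernel computations)

HONEST FRAMING (pub-omega census; verbatim): lottery ticket; floor = certified bounds/negative ranges.
Census STRUCTURE (seat pub-omega-stpp-2 gen 27, 2026-08-28), family (b2).  Rows for the kill of the leaf `{(3,3,3),(3,3,4)} @ ℤ₆₁` by the slack-2
partition law (stpp-1 lineage: shapes `STPPVosperSlackTwoShapes.lean`, checker `caseADeadQ'` of `STPPVosperSlackTwoCheckers.lean`, soundness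
`caseADeadQ'_false_of_isAP`; row interface `slack_two_caseC_of_rowsQ` of `STPPVosperSlackTwoLawABQ.lean`): reading `(a, b, c) = (4, 3, 3)` of the block
`(3,3,4)`, the other block `(3, 3, 3)`, `L = z = 9`.  Case B′ = case A of the role-swapped family `(B, A, C)` (free shape = the 4-set `Aᵢ`): rows
`caseADeadQ' 61 3 3 9 9 3 3 3 Q` over the four-shapes `qShapes 61 4 lo hi`, indices `[29187, 30243)` — the HEAVY region (smallest gap 3: the pattern `[0,3) + Q` is an
interval or near-interval of `ℤ/61`, up to 2 040 admissible tilings per shape), chunked by the faithful cost mirror HOME `pub-omega-stpp-2-g27/code/costB.py`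
(≈ 230 s of kernel per 10⁶ mirror steps, calibrated on `…Rows61B1`) to ≤ 0.3·10⁶ steps ≈ 70 s; each chunk ONE `decide +kernel` certifying, shape by shape,
`dihedralSmaller 61 Q` (not the minimal-mask representative — no checker run) or `caseADeadQ' 61 3 3 9 9 3 3 3 Q`.  Assembly in `STPPVosperSlackTwoRows61BAsm.lean`.
Nothing here is progress on `ω`.

References: H. Cohn, R. Kleinberg, B. Szegedy, C. Umans, FOCS 2005 (arXiv:math/0511460), Def. 5.1; A. G. Vosper, J. London Math. Soc. 31 (1956).
-/

namespace Summit.MatrixMultiplication.OmegaCensus.CubeNB.S2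

/-- Case B′ rows, shape indices `[29187, 29951)` (≈ 0.3 · 10⁶ mirror steps): each shape is non-representative or certified dead. [folklore] -/
theorem rowsB61_29187_29951 : ((qShapes 61 4 29187 29951).all fun Q => dihedralSmaller 61 Q || caseADeadQ' 61 3 3 9 9 3 3 3 Q) = true := by
  decide +kernel

/-- Case B′ rows, shape indices `[29951, 29990)` (≈ 0.07 · 10⁶ mirror steps): each shape is non-representative or certified dead. [folklore] -/
theorem rowsB61_29951_29990 : ((qShapes 61 4 29951 29990).all fun Q => dihedralSmaller 61 Q || caseADeadQ' 61 3 3 9 9 3 3 3 Q) = true := by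
  decide +kernel

/-- Case B′ rows, shape indices `[29990, 30118)` (≈ 0.29 · 10⁶ mirror steps): each shape is non-representative or certified dead. [folklore] -/
theorem rowsB61_29990_30118 : ((qShapes 61 4 29990 30118).all fun Q => dihedralSmaller 61 Q || caseADeadQ' 61 3 3 9 9 3 3 3 Q) = true := by
  decide +kernel

/-- Case B′ rows, shape indices `[30118, 30243)` (≈ 0.25 · 10⁶ mirror steps): each shape is non-representative or certified dead. [folklore] -/
theorem rowsB61_30118_30243 : ((qShapes 61 4 30118 30243).all fun Q => dihedralSmaller 61 Q || caseADeadQ' 61 3 3 9 9 3 3 3 Q) = true := by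
  decide +kernel

end Summit.MatrixMultiplication.OmegaCensus.CubeNB.S2
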